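import Mathlib.NumberTheory.NumberField.Units.DirichletTheorem
import Literature.NumberTheory.GaloisRepresentations.HeckeCharacterProofs
import Literature.NumberTheory.Automorphic.IdeleIdealClass
import HarnessLib

/-!
# Unit ideles `𝕌_K = ∏_{w∣∞} K_wˣ × ∏_v 𝒪_vˣ`, their local components, and the class-number step

Trunk `GalRep` / `AutomorphicAxiomatic`, topic `NumberTheory/GaloisRepresentations` (ideles of a
number field; companion to `HeckeCharacter.lean`, `HeckeCharacterProofs.lean` and
`Automorphic/IdeleIdealClass.lean`); namespace `Literature` (and `Literature.Automorphic.FiniteAdeleRing` for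
the lemmas extending `IdeleIdealClass.lean`).

Let `K` be a number field with idele group `𝕀_K = Literature.ideleGroup K`.  This file provides the
general idele-theoretic notions used to turn characters of the local unit groups `𝒪_vˣ` into
characters of the idele class group `C_K = 𝕀_K / Kˣ` (Washington, *Introduction to Cyclotomic
Fields*, §13.1, proof of Thm. 13.4: the exact sequence `Ē → ∏_{𝔭∣p} U_𝔭 → Gal(K̃H/H) → 0` and the
finiteness of `Gal(H/K) = Cl_K`), consumed by
`Literature/NumberTheory/EllipticCurves/ZpExtensionIdelicProofs.lean` (the `K`-side of
`Literature.NumberTheory.EllipticCurves.ZpExtension.exists_isAnticyclotomic`):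

* `Literature.unitIdeles K : Subgroup (ideleGroup K)` — the **unit ideles** `I_K^{S_∞} =
  ∏_{w∣∞} K_wˣ × ∏_{v∤∞} U_v` (Neukirch, *Algebraic Number Theory*, Ch. VI §1): ideles all of whose
  finite components are local units; `mem_unitIdeles_iff`, `mem_unitIdeles_iff_mem_and_inv_mem`,
  `isOpen_unitIdeles` (it is an open subgroup).
* `Literature.unitIdeles.localUnit v : unitIdeles K →* 𝒪_vˣ` — the local component at a finite place,
  `coe_localUnit`, `continuous_localUnit`.
* `Literature.NumberTheory.GaloisRepresentations.unitsMap_snd_principalIdele`, `Literature.NumberTheory.GaloisRepresentations.exists_units_eq_of_mem_unitIdeles` — a principal idele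
  which is a unit idele is the idele of a global unit (`Kˣ ∩ I_K^{S_∞} = 𝓞_Kˣ`).
* In `namespace Literature.Automorphic.FiniteAdeleRing` (extending `IdeleIdealClass.lean`):
  `toFractionalIdeal_mul`, `idealClass_mul`, `idealClass_one`, `idealClass_pow`, and the
  **class-number step** `exists_unitOrd_pow_card_classGroup_eq_zero`: for every finite idele `x`,
  `x^h ∈ Kˣ · ∏_v 𝒪_vˣ` with `h` the class number.

## References

* J. Neukirch, *Algebraic Number Theory*, Springer 1999, Ch. VI §1 (ideles, `I_K^S`,
  Prop. (1.3)–(1.4)).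
* J. W. S. Cassels, A. Fröhlich (eds.), *Algebraic Number Theory* (1967), Ch. II §§16–18.
* L. C. Washington, *Introduction to Cyclotomic Fields*, 2nd ed., GTM 83, §13.1, Thm. 13.4.
-/
noncomputable section

open NumberField IsDedekindDomain Topology
open scoped RestrictedProduct

namespace Literature.NumberTheory.GaloisRepresentations

universe u

variable (K : Type u) [Field K] [NumberField K]

/-- The **unit ideles** `𝕌_K = ∏_{w ∣ ∞} K_wˣ × ∏_{v ∤ ∞} 𝒪_vˣ ⊆ 𝕀_K`: ideles all of whose finite
components are local units (no condition at the infinite places), i.e. Neukirch's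
`I_K^{S_∞}` for `S_∞` the set of infinite places.  As a subgroup of `Literature.ideleGroup K`.
Ref: Neukirch, *Algebraic Number Theory*, Ch. VI §1, p. 357–358 (`I_K^S = ∏_{𝔭∈S} K_𝔭ˣ × ∏_{𝔭∉S} U_𝔭`);
Cassels–Fröhlich, Ch. II §16. [cite: NeukirchANT1999, Ch. VI §1] -/
def unitIdeles : Subgroup (ideleGroup K) where
  carrier := {x | ∀ v : HeightOneSpectrum (𝓞 K), Valued.v ((x : AdeleRing (𝓞 K) K).2 v) = 1}
  one_mem' := fun v => by
    have h1 : (((1 : ideleGroup K) : AdeleRing (𝓞 K) K).2 v) = 1 := rfl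
    exact (congrArg Valued.v h1).trans (map_one _)
  mul_mem' := fun {x y} hx hy v => by
    rw [ideleGroup_val_snd_mul, map_mul, hx v, hy v, mul_one]
  inv_mem' := fun {x} hx v => by
    rw [ideleGroup_val_inv_snd, map_inv₀, hx v, inv_one]

variable {K}

/-- Membership in `unitIdeles`: all finite components have valuation `1`. [folklore] -/
theorem mem_unitIdeles_iff {x : ideleGroup K} :
    x ∈ unitIdeles K ↔ ∀ v : HeightOneSpectrum (𝓞 K), Valued.v ((x : AdeleRing (𝓞 K) K).2 v) = 1 :=
  Iff.rfl

/-- An idele is a unit idele iff its finite part and the finite part of its inverse are integral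
at every finite place. [folklore] -/
theorem mem_unitIdeles_iff_mem_and_inv_mem {x : ideleGroup K} :
    x ∈ unitIdeles K ↔
      (∀ v : HeightOneSpectrum (𝓞 K), (x : AdeleRing (𝓞 K) K).2 v ∈ v.adicCompletionIntegers K) ∧
      ∀ v : HeightOneSpectrum (𝓞 K),
        ((x⁻¹ : ideleGroup K) : AdeleRing (𝓞 K) K).2 v ∈ v.adicCompletionIntegers K := by
  simp only [mem_unitIdeles_iff, HeightOneSpectrum.mem_adicCompletionIntegers, ideleGroup_val_inv_snd,
    map_inv₀]
  constructor
  · intro h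
    exact ⟨fun v => (h v).le, fun v => by rw [h v, inv_one]⟩
  · rintro ⟨h1, h2⟩ v
    have hne : Valued.v ((x : AdeleRing (𝓞 K) K).2 v) ≠ 0 := fun h0 => by
      have hmul : (x : AdeleRing (𝓞 K) K).2 v * ((x⁻¹ : ideleGroup K) : AdeleRing (𝓞 K) K).2 v = 1 := by
        rw [← ideleGroup_val_snd_mul, mul_inv_cancel]; rfl
      have := congrArg Valued.v hmul
      rw [map_mul, h0, zero_mul, map_one] at this
      exact zero_ne_one this
    refine le_antisymm (h1 v) ?_
    have := h2 v
    rwa [inv_le_one₀ (zero_lt_iff.2 hne)] at this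

variable (K) in
/-- **`𝕌_K` is open in `𝕀_K`** (it is `∏_{w∣∞} K_wˣ × ∏_v 𝒪_vˣ`, a basic open subgroup of the
restricted product).  Ref: Neukirch, *Algebraic Number Theory*, Ch. VI §1 (the topology of
`I_K`: `I_K^S` open); Cassels–Fröhlich, Ch. II §16. [folklore] -/
theorem isOpen_unitIdeles : IsOpen (unitIdeles K : Set (ideleGroup K)) := by
  have hO : IsOpen {f : FiniteAdeleRing (𝓞 K) K |
      ∀ v : HeightOneSpectrum (𝓞 K), f v ∈ v.adicCompletionIntegers K} :=
    RestrictedProduct.isOpen_forall_mem fun v => Valued.isOpen_valuationSubring _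
  have h1 : Continuous fun x : ideleGroup K => (x : AdeleRing (𝓞 K) K).2 :=
    continuous_snd.comp Units.continuous_val
  have h2 : Continuous fun x : ideleGroup K => ((x⁻¹ : ideleGroup K) : AdeleRing (𝓞 K) K).2 :=
    continuous_snd.comp Units.continuous_coe_inv
  have heq : (unitIdeles K : Set (ideleGroup K)) =
      (fun x : ideleGroup K => (x : AdeleRing (𝓞 K) K).2) ⁻¹'
          {f | ∀ v : HeightOneSpectrum (𝓞 K), f v ∈ v.adicCompletionIntegers K} ∩
        (fun x : ideleGroup K => ((x⁻¹ : ideleGroup K) : AdeleRing (𝓞 K) K).2) ⁻¹'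
          {f | ∀ v : HeightOneSpectrum (𝓞 K), f v ∈ v.adicCompletionIntegers K} := by
    ext x
    exact mem_unitIdeles_iff_mem_and_inv_mem
  rw [heq]
  exact (hO.preimage h1).inter (hO.preimage h2)

namespace unitIdeles

/-- The **local component** `𝕌_K → 𝒪_vˣ`, `x ↦ x_v`, at a finite place `v` (a group
homomorphism).  Ref: Neukirch, *Algebraic Number Theory*, Ch. VI §1. [folklore] -/
def localUnit (v : HeightOneSpectrum (𝓞 K)) : unitIdeles K →* (v.adicCompletionIntegers K)ˣ where
  toFun x :=
    { val := ⟨((x : ideleGroup K) : AdeleRing (𝓞 K) K).2 v,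
        (mem_unitIdeles_iff_mem_and_inv_mem.1 x.2).1 v⟩
      inv := ⟨(((x : ideleGroup K)⁻¹ : ideleGroup K) : AdeleRing (𝓞 K) K).2 v,
        (mem_unitIdeles_iff_mem_and_inv_mem.1 x.2).2 v⟩
      val_inv := Subtype.ext (by
        change ((x : ideleGroup K) : AdeleRing (𝓞 K) K).2 v *
          (((x : ideleGroup K)⁻¹ : ideleGroup K) : AdeleRing (𝓞 K) K).2 v = 1
        rw [← ideleGroup_val_snd_mul, mul_inv_cancel]; rfl)
      inv_val := Subtype.ext (by
        change (((x : ideleGroup K)⁻¹ : ideleGroup K) : AdeleRing (𝓞 K) K).2 v *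
          ((x : ideleGroup K) : AdeleRing (𝓞 K) K).2 v = 1
        rw [← ideleGroup_val_snd_mul, inv_mul_cancel]; rfl) }
  map_one' := Units.ext (Subtype.ext rfl)
  map_mul' x y := Units.ext (Subtype.ext rfl)

/-- `localUnit v x` has underlying element `x_v`. [folklore] -/
@[simp]
theorem coe_localUnit (v : HeightOneSpectrum (𝓞 K)) (x : unitIdeles K) :
    ((localUnit v x : (v.adicCompletionIntegers K)ˣ) : v.adicCompletion K) =
      ((x : ideleGroup K) : AdeleRing (𝓞 K) K).2 v :=
  rfl

/-- `(localUnit v x)⁻¹` has underlying element `(x⁻¹)_v`. [folklore] -/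
theorem coe_localUnit_inv (v : HeightOneSpectrum (𝓞 K)) (x : unitIdeles K) :
    (((localUnit v x)⁻¹ : (v.adicCompletionIntegers K)ˣ) : v.adicCompletion K) =
      (((x : ideleGroup K)⁻¹ : ideleGroup K) : AdeleRing (𝓞 K) K).2 v :=
  rfl

/-- The local component `𝕌_K → 𝒪_vˣ` is continuous (the components of an idele and of its
inverse depend continuously on it).  Ref: Neukirch, *Algebraic Number Theory*, Ch. VI §1.
[folklore] -/
theorem continuous_localUnit (v : HeightOneSpectrum (𝓞 K)) : Continuous (localUnit (K := K) v) := by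
  have hev : Continuous fun f : FiniteAdeleRing (𝓞 K) K => f v := RestrictedProduct.continuous_eval v
  refine Units.continuous_iff.2 ⟨?_, ?_⟩
  · refine continuous_induced_rng.2 ?_
    exact hev.comp (continuous_snd.comp (Units.continuous_val.comp continuous_subtype_val))
  · refine continuous_induced_rng.2 ?_
    exact hev.comp (continuous_snd.comp (Units.continuous_coe_inv.comp continuous_subtype_val))

end unitIdeles

/-! ### Principal ideles -/

/-- The finite part of a principal idele is Mathlib's `FiniteAdeleRing.unitEmbedding`. [folklore] -/
theorem unitsMap_snd_principalIdele (k : Kˣ) :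
    Units.map (RingHom.snd (InfiniteAdeleRing K) (FiniteAdeleRing (𝓞 K) K)).toMonoidHom
      (principalIdele K k) = FiniteAdeleRing.unitEmbedding (𝓞 K) K k :=
  Units.ext rfl

/-- **A principal idele which is a unit idele comes from a global unit**: if `k ∈ Kˣ` has
`|k|_v = 1` at all finite places then `k ∈ 𝓞_Kˣ`.  Ref: Neukirch, *Algebraic Number Theory*,
Ch. VI §1, Prop. (1.3) proof (`K^S ∩ … `); Cassels–Fröhlich Ch. II §18. [folklore] -/
theorem exists_units_eq_of_mem_unitIdeles {k : Kˣ} (hk : principalIdele K k ∈ unitIdeles K) :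
    ∃ ε : (𝓞 K)ˣ, algebraMap (𝓞 K) K (ε : 𝓞 K) = k := by
  have hval : ∀ v : HeightOneSpectrum (𝓞 K), v.valuation K (k : K) = 1 := fun v => by
    have := hk v
    rwa [principalIdele_snd, valued_algebraMap_adicCompletion] at this
  obtain ⟨r, hr⟩ := HeightOneSpectrum.mem_integers_of_valuation_le_one K (k : K) fun v => (hval v).le
  obtain ⟨r', hr'⟩ := HeightOneSpectrum.mem_integers_of_valuation_le_one K ((k⁻¹ : Kˣ) : K) fun v => by
    rw [Units.val_inv_eq_inv_val, map_inv₀, hval v, inv_one]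
  have hinj := FaithfulSMul.algebraMap_injective (𝓞 K) K
  refine ⟨⟨r, r', hinj ?_, hinj ?_⟩, hr⟩
  · rw [map_mul, map_one, hr, hr', Units.val_inv_eq_inv_val, mul_inv_cancel₀ k.ne_zero]
  · rw [map_mul, map_one, hr, hr', Units.val_inv_eq_inv_val, inv_mul_cancel₀ k.ne_zero]

/-! ### The class-number step: `x^h ∈ Kˣ · 𝕌` for finite ideles -/

section Automorphic
namespace FiniteAdeleRing

variable {R : Type*} [CommRing R] [IsDedekindDomain R] {F : Type*} [Field F] [Algebra R F]
  [IsFractionRing R F]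

/-- The fractional ideal of a product of finite ideles is the product of their fractional ideals
(compare multiplicities: `ord_v (x y) = ord_v x + ord_v y`).  Ref: Cassels–Fröhlich, Ch. II §17
(`J_k → I_k` is a homomorphism). [folklore] -/
theorem toFractionalIdeal_mul (x y : (FiniteAdeleRing R F)ˣ) :
    Automorphic.FiniteAdeleRing.toFractionalIdeal R F (x * y) =
      Automorphic.FiniteAdeleRing.toFractionalIdeal R F x * Automorphic.FiniteAdeleRing.toFractionalIdeal R F y := by
  rw [← FractionalIdeal.finprod_heightOneSpectrum_factorization' F
      (Automorphic.FiniteAdeleRing.toFractionalIdeal_ne_zero (x * y)),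
    ← FractionalIdeal.finprod_heightOneSpectrum_factorization' F
      (mul_ne_zero (Automorphic.FiniteAdeleRing.toFractionalIdeal_ne_zero x)
        (Automorphic.FiniteAdeleRing.toFractionalIdeal_ne_zero y))]
  refine finprod_congr fun v => ?_
  rw [FractionalIdeal.count_mul F v (Automorphic.FiniteAdeleRing.toFractionalIdeal_ne_zero x)
      (Automorphic.FiniteAdeleRing.toFractionalIdeal_ne_zero y),
    Automorphic.FiniteAdeleRing.count_toFractionalIdeal, Automorphic.FiniteAdeleRing.count_toFractionalIdeal,
    Automorphic.FiniteAdeleRing.count_toFractionalIdeal, Automorphic.FiniteAdeleRing.unitOrd_mul]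

/-- The ideal class of a finite idele is multiplicative.  Ref: Cassels–Fröhlich, Ch. II §17.
[folklore] -/
theorem idealClass_mul (x y : (FiniteAdeleRing R F)ˣ) :
    Automorphic.FiniteAdeleRing.idealClass R F (x * y) =
      Automorphic.FiniteAdeleRing.idealClass R F x * Automorphic.FiniteAdeleRing.idealClass R F y := by
  unfold Automorphic.FiniteAdeleRing.idealClass
  rw [← map_mul]
  congr 1
  ext : 1
  rw [Units.val_mul, Units.val_mk0, Units.val_mk0, Units.val_mk0, toFractionalIdeal_mul]

/-- The ideal class of the trivial finite idele is trivial. [folklore] -/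
theorem idealClass_one : Automorphic.FiniteAdeleRing.idealClass R F (1 : (FiniteAdeleRing R F)ˣ) = 1 := by
  have h := idealClass_mul (R := R) (F := F) 1 1
  rw [mul_one] at h
  exact left_eq_mul.1 h

/-- The ideal class of a power. [folklore] -/
theorem idealClass_pow (x : (FiniteAdeleRing R F)ˣ) (n : ℕ) :
    Automorphic.FiniteAdeleRing.idealClass R F (x ^ n) = Automorphic.FiniteAdeleRing.idealClass R F x ^ n := by
  induction n with
  | zero => rw [pow_zero, pow_zero, idealClass_one]
  | succ n ih => rw [pow_succ, pow_succ, idealClass_mul, ih]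

/-- **`x^h` is principal times a unit idele**, `h` the class number: for every finite idele `x`
there is `k ∈ Fˣ` with `ord_v (x^h k⁻¹) = 0` for all `v` (the class of `∏ v^{ord_v x}` has order
dividing `h`).  Ref: Cassels–Fröhlich, Ch. II §17 Theorem (finiteness of the class number) and
§18; Washington, *Introduction to Cyclotomic Fields*, §13.1, proof of Thm. 13.4 (the exact
sequence `0 → Ē → U → Gal → Cl`). [folklore] -/
theorem exists_unitOrd_pow_card_classGroup_eq_zero [Fintype (ClassGroup R)] (x : (FiniteAdeleRing R F)ˣ) :
    ∃ k : Fˣ, ∀ v : HeightOneSpectrum R,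
      Automorphic.FiniteAdeleRing.unitOrd R F (x ^ Fintype.card (ClassGroup R) *
        (FiniteAdeleRing.unitEmbedding R F k)⁻¹) v = 0 := by
  have h : Automorphic.FiniteAdeleRing.idealClass R F 1 =
      Automorphic.FiniteAdeleRing.idealClass R F (x ^ Fintype.card (ClassGroup R)) := by
    rw [idealClass_pow, pow_card_eq_one, idealClass_one]
  obtain ⟨k, hk⟩ := Automorphic.FiniteAdeleRing.exists_unitOrd_eq_zero_of_idealClass_eq h
  exact ⟨k, fun v => by simpa only [inv_one, mul_one] using hk v⟩

end FiniteAdeleRing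
end Automorphic


end Literature.NumberTheory.GaloisRepresentations
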